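import Mathlib
import Summits.SmoothPoincare4.SmoothPoincare4.Theses.SullivanDual
import Literature.Geometry.Symplectic.StandardEnd
import Literature.Geometry.Symplectic.JHolomorphicMap
import Literature.Geometry.Symplectic.JHolomorphicLocalIntersections
import Summits.SmoothPoincare4.SmoothPoincare4.Theorems.SullivanDualTameOrBrodyR4PencilDefs
import Summits.SmoothPoincare4.SmoothPoincare4.Theorems.SullivanDualTameOrBrodyR4DeepReduction6
import Summits.SmoothPoincare4.SmoothPoincare4.Theorems.SullivanDualTameOrBrodyR4StubLocalFamilyUnique
import Summits.SmoothPoincare4.SmoothPoincare4.Theorems.SullivanDualTameOrBrodyR4HelperImmersedLimitsOfNoCusp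
import Literature.Geometry.Symplectic.JHolomorphicRepresentationFormula

/-!
# Crux `TameOrBrodyR4` (stmt-SmoothPoincare4-7826) — line `Sketch` (idea `anchored-pencils`): skeleton v20 (SORRY-FREE)

Lead c7, 2026-08-17 (v20): the single stub of v19 is now a THEOREM —
`Literature.Geometry.Symplectic.jHolomorphic_immersed_of_limitEmbedded_punctured_holds`
(`Literature/Geometry/Symplectic/JHolomorphicRepresentationFormula.lean`, lead c7: Wendl B.23 with (B.12) assembled from
the adapted normal form, the rotated branch, the Cauchy–Riemann inequality in the original variable and the punctured
similarity principle); the composition below is sorry-free and is landed as `Theorems/SullivanDualTameOrBrodyR4.lean`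
(`TameOrBrodyR4_proof`). Lead c6's header follows. History (v1–v18) in `Lines/Sketch.md`. Since v18 the crux was kernel-reduced
in the tree (`…DeepReduction6.lean`, `TameOrBrodyR4_of_deep2`) to two flat-`ℝ⁴` analytic inputs:

* CORE-A `stub_localFamilyUnique` — **PROVED** (v19): the implicit-function-theorem package for the
  vorticity form of the normal Cauchy–Riemann problem of an embedded pencil member with the point
  constraint at infinity, with automatic transversality and local uniqueness; tree files
  `Theorems/SullivanDualTameOrBrodyR4{CoreA*,Helper*,StubLocalFamilyUnique}.lean` and
  `Literature/Analysis/{Complex,FunctionSpaces,Calculus}/…`, `Literature/Geometry/Symplectic/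
  JHolomorphicRegularityHolder*.lean` (≈ 40 accepted proposals of this lead and its workers).
* CORE-B `stub_immersedLimits` — no cusps in `C¹_loc`-limits of embedded members: **REDUCED**
  (v19) to the Literature named fact
  `Literature.Geometry.Symplectic.jHolomorphic_immersed_of_limitEmbedded_punctured` (D. McDuff,
  J. Differential Geom. 34 (1991), Thm 1.4 / Cor. 4.4), instantiated on the model space `ℝ⁴`
  through Literature's `jHolomorphicLimitOfEmbedded_isEmbedded_of_persist_of_noCusp` and the
  proved persistence of isolated intersections (`helper_immersedLimitsOfNoCusp`). That named fact
  is being discharged by the Literature debt programme (`JHolomorphicCuspDoublePoints*.lean`).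

**v19: the ONLY stub was `stub_noCusp`, whose statement IS that named fact; v20: it is a theorem.** Composition:
`TameOrBrodyR4_of := TameOrBrodyR4_of_deep2 stub_localFamilyUnique (helper_immersedLimitsOfNoCusp stub_noCusp)`
(also landed as the conditional result `helper_tameOrBrodyR4OfNoCusp`).
-/

-- the registered namespace `Summit.SmoothPoincare4.SmoothPoincare4.…` repeats a component
set_option linter.dupNamespace false

noncomputable section

open scoped ContDiff Topology InnerProductSpace
open Filter Set Metric MeasureTheory Literature.Geometry.Symplectic

namespace Summit.SmoothPoincare4.SmoothPoincare4.Cruxes.TameOrBrodyR4.Sketch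

/-! ### §1 The stub: McDuff's no-cusp theorem (Literature named fact) -/

/-- **Stub (the line's single remaining input): no cusps in limits of embedded `J`-curves**
(D. McDuff 1991, Thm 1.4 / Cor. 4.4) — verbatim the Literature named fact
`Literature.Geometry.Symplectic.jHolomorphic_immersed_of_limitEmbedded_punctured`, under discharge
by the Literature debt programme; when `…_holds` lands this stub is that theorem. -/
theorem stub_noCusp :
    Literature.Geometry.Symplectic.jHolomorphic_immersed_of_limitEmbedded_punctured :=
  Literature.Geometry.Symplectic.jHolomorphic_immersed_of_limitEmbedded_punctured_holds

/-! ### §2 Composition: the crux BY NAME -/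

/-- **The crux from CORE-A (proved: `stub_localFamilyUnique`) and CORE-B modulo the stub
(`helper_immersedLimitsOfNoCusp stub_noCusp`)**, by the tree's `TameOrBrodyR4_of_deep2`:
`Theses.SullivanDual.TameOrBrodyR4` by name. -/
theorem TameOrBrodyR4_of : Summit.SmoothPoincare4.SmoothPoincare4.Theses.SullivanDual.TameOrBrodyR4 :=
  TameOrBrodyR4_of_deep2 stub_localFamilyUnique (helper_immersedLimitsOfNoCusp stub_noCusp)

end Summit.SmoothPoincare4.SmoothPoincare4.Cruxes.TameOrBrodyR4.Sketch
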